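import Summits.AtomisticToContinuum.Crystallization.Theorems.ChartedZeroExcessLayeredLatticeLiouvilleJ
import Summits.AtomisticToContinuum.Crystallization.Theorems.ChartedPlanarOrderDoorDischarged

/-!
# ChartedZeroExcessLayered · LatticeLiouville — part L: §G «MinimisingDoor», the currency and the door column (decomp-a2c lens-2 generation 27;
NEW content, imports part J and the discharged door; pieces, glue and columns in part M, the energy lever in part N)

THE LENS «structural dichotomy (special vs generic)» applied to the DOOR ITSELF.  The v9/g26 pieces beneath N = `ChartedZeroExcessLayered` are all
stated over `IsDoorSet δ S` (rooted · δ-separated · clean · SINGLE-SITE Nash · Barlow-charted).  But the door's consumer of record, K3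
`sparseMisfit_of_bulkDoor`, applies BULK|door ONLY to configurations that are ALSO e⋆-μ-ground states (`IsEStarGSC`: summability + the
finite-replacement inequality `E(patch | rest) − e⋆·n ≤ E(competitor | rest) − e⋆·k` for every finite patch and every competitor), because
`SparseMisfit`'s binder carries `IsEStarGSC μ` — and that hypothesis is FREE at law level: route item `MuEquilibriumDoor` (stmt-27073) is CLOSED
(`GrainCoreNetworkSplitMuEquilibriumDoor.muEquilibriumDoor`, p816834).  So every piece of the (β) column may be RESTRICTED to

  SPECIAL = MINIMISING door sets   `IsDoorSetPG aHi δ S := IsDoorSetP aHi δ S ∧ IsEStarGSC (μS S)`   (the only door sets N ever produces),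
  GENERIC = merely single-site-Nash door sets (where localised second equilibria — «cores» — and wild critical points live),

and the column needs the special class ONLY.  Every restricted piece X_G is WEAKER-or-equal than X (one hypothesis added; seams X ⟹ X_G are
one line, part M), and the restriction hands the provers of R / A∞ / K / H_pert the tools of MINIMISERS that critical points do not have:
comparison (cut-and-paste) energy bounds — the tree's `BindingSurface` (window excess `≤ C₁R²`, PROVED `bindingSurface_holds`, p816066) IS such a
bound and is consumed in part N; Caccioppoli / reverse-Hölder inequalities for minimisers; ε-regularity at small EXCESS without small amplitude
(continuum: minimisers of quasiconvex functionals are partially regular, while Lipschitz critical points can be nowhere C¹); defect excision.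
In the continuum dictionary the NASH door is the regime of the JOHN RADIUS (inside the convexity radius of the stored energy every equilibrium is
the minimiser — census TAG 174 JOHN-RADIUS measures whether the clean tube at oscillation 1/16 is inside it), the GSC door needs only COERCIVITY
of the energy (growth away from the well), which survives where convexity fails: the cut makes the column robust to TAG 174's outcome.

THIS FILE (currency + the door column re-proved in GSC currency; DEF-light, no sorry, axioms standard):
* `IsDoorSetPG aHi δ S`, `isDoorSetPG_one_iff`, `isDoorSetPG_mono`, `isRootedHardCore_μS`;
* `BulkDefectGapDoorG` = BULK|door with the ONE extra hypothesis `IsEStarGSC (μS S)` (WEAKER-or-equal: `bulkDoorG_of_bulkDoor`);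
  `DoorPeriodicPG Λ aHi` = L1′♮ on GSC door sets (WEAKER-or-equal: `doorPeriodicPG_of_P`); the cut `bulkDoorG_of_periodicG : DoorPeriodicPG Λ 1 →
  PeriodicBulkGapDoor Λ → BulkDefectGapDoorG` (HBG″ UNCHANGED — it already carries `TwoPeriodic Λ S`, and is applied to GSC door sets only);
* ★ K3_G `sparseMisfit_of_bulkDoorG : BulkDefectGapDoorG → BindingSurface → WindowCounting → SparseMisfit ν` — K3 VERBATIM with the GSC
  hypothesis of `SparseMisfit`'s binder (line `hgsc`) threaded into BULK|door·G (the tree proof already had it in scope and dropped it);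
* ★ `gap_and_pert_1_50_of_bulkDoorG`, `gap_and_pert_1_50_of_periodicG : DoorPeriodicPG Λ 1 → PeriodicBulkGapDoor Λ → VisibleGap (1/50) ∧
  PertRegime (1/50)` — N's registered conclusions from the GSC-door Liouville leaf, door / SparseNull / BindingSurface / WindowCounting discharged
  BY NAME (`ChartedPlanarOrderDoorDischarged.visibleGap_of_sparseMisfit`, `…pertRegime_of_sparseMisfit`).
STRICTNESS of the cut (is X_G STRICTLY weaker than X?): UNDECIDED-with-test.  A witness is a clean, Barlow-charted, single-site-Nash configuration
violating the finite-replacement inequality; every CANDIDATE CORE of census TAG 171 CORE-HUNT (a metastable = Nash, clean, non-layered relaxed end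
state with positive energy above the perfect ball and the same far field) IS such a witness (the perfect patch beats it at equal particle number), so
TAG 171 decides the strictness of K ⟹ K_G and U ⟹ U_G directly: cores found ⇒ K FALSE and K_G untouched.
-/

noncomputable section

open scoped BigOperators
open MeasureTheory Set Metric
open Summit.AtomisticToContinuum.Crystallization.Theorems.ChartedPlanarOrderRigidityDoor
open Summit.AtomisticToContinuum.Crystallization.Theorems.ChartedPlanarOrderDensityDichotomy
open Summit.AtomisticToContinuum.Crystallization.Theorems.ChartedPlanarOrderMesoCut (IsDoorSet BulkDefectGapDoor)
open Summit.AtomisticToContinuum.Crystallization.Theorems.ChartedPlanarOrderDoorLayered (TwoPeriodic DoorPeriodic PeriodicBulkGapDoor)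
open Summit.AtomisticToContinuum.Crystallization.Theorems.ChartedPlanarOrderCleanScaleP (IsDoorSetP DoorPeriodicP isDoorSetP_mono isDoorSetP_one_iff)

namespace Summit.AtomisticToContinuum.Crystallization.Theorems.ChartedZeroExcessLayeredLatticeLiouville

/-! ## §G.1  The MINIMISING door: `IsDoorSetPG` -/

/-- **GSC door set at pattern-scale ceiling `aHi`**: an `aHi`-door set (rooted, `δ`-separated, `(1/16, 9/10, aHi)`-clean, single-site Nash,
Barlow-charted — lens-3's `IsDoorSetP`) whose counting measure is IN ADDITION an e⋆-μ-ground-state configuration (`IsEStarGSC`, the VERBATIM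
conclusion of the closed route item `MuEquilibriumDoor`).  The SPECIAL (minimising) class of the lens-2 g27 cut; the only door sets N produces.
[this file, g27] -/
def IsDoorSetPG (aHi δ : ℝ) (S : Set E3) : Prop :=
  IsDoorSetP aHi δ S ∧ IsEStarGSC (μS S)

/-- a GSC door set is a door set. -/
theorem IsDoorSetPG.isDoorSetP {aHi δ : ℝ} {S : Set E3} (h : IsDoorSetPG aHi δ S) : IsDoorSetP aHi δ S := h.1

/-- a GSC door set is e⋆-GSC. -/
theorem IsDoorSetPG.gsc {aHi δ : ℝ} {S : Set E3} (h : IsDoorSetPG aHi δ S) : IsEStarGSC (μS S) := h.2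

/-- at `aHi = 1` the GSC door is N's door `IsDoorSet` plus `IsEStarGSC`. -/
theorem isDoorSetPG_one_iff (δ : ℝ) (S : Set E3) : IsDoorSetPG 1 δ S ↔ IsDoorSet δ S ∧ IsEStarGSC (μS S) := Iff.rfl

/-- the GSC door is MONOTONE in the ceiling (as `IsDoorSetP`). -/
theorem isDoorSetPG_mono {aHi aHi' δ : ℝ} (hle : aHi ≤ aHi') {S : Set E3} (h : IsDoorSetPG aHi δ S) : IsDoorSetPG aHi' δ S :=
  ⟨isDoorSetP_mono hle h.1, h.2⟩

/-- the counting measure of a rooted separated set is a rooted `δ`-hard-core configuration (Literature binder of `BindingSurface` / `WindowCounting`). -/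
theorem isRootedHardCore_μS {δ : ℝ} {S : Set E3} (h0 : (0 : E3) ∈ S) (hsep : IsSep δ S) :
    Literature.Probability.Process.IsRootedHardCore δ (μS S) :=
  ⟨S, h0, hsep, rfl⟩

/-- in particular for GSC door sets. -/
theorem IsDoorSetPG.isRootedHardCore {aHi δ : ℝ} {S : Set E3} (h : IsDoorSetPG aHi δ S) :
    Literature.Probability.Process.IsRootedHardCore δ (μS S) :=
  isRootedHardCore_μS h.1.1 h.1.2.1

/-! ## §G.2  The door column in GSC currency: L1′♮_G ∧ HBG″ ⟹ BULK|door·G ⟹ D♯ ⟹ GAP(1/50) ∧ PERT(1/50) -/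

/-- **L1′♮_G «DoorPeriodicPG Λ aHi»** — the exact discrete Liouville leaf RESTRICTED to GSC door sets: every e⋆-GSC `aHi`-door configuration has
two independent exact periods of length `≤ Λ`.  WEAKER-or-equal than `DoorPeriodicP Λ aHi` (`doorPeriodicPG_of_P`). [this file, g27] -/
def DoorPeriodicPG (Λ aHi : ℝ) : Prop :=
  ∀ δ : ℝ, 0 < δ → ∀ S : Set E3, IsDoorSetPG aHi δ S → TwoPeriodic Λ S

/-- L1′♮ ⟹ L1′♮_G (drop the GSC hypothesis). -/
theorem doorPeriodicPG_of_P {Λ aHi : ℝ} (h : DoorPeriodicP Λ aHi) : DoorPeriodicPG Λ aHi :=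
  fun δ hδ S hS => h δ hδ S hS.1

/-- at ceiling 1: `DoorPeriodic Λ ⟹ DoorPeriodicPG Λ 1`. -/
theorem doorPeriodicPG_one_of_doorPeriodic {Λ : ℝ} (h : DoorPeriodic Λ) : DoorPeriodicPG Λ 1 :=
  fun δ hδ S hS => h δ hδ S ((isDoorSetP_one_iff δ S).1 hS.1)

/-- L1′♮_G is ANTITONE in the ceiling. -/
theorem DoorPeriodicPG.anti {Λ aHi aHi' : ℝ} (hle : aHi ≤ aHi') (h : DoorPeriodicPG Λ aHi') : DoorPeriodicPG Λ aHi :=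
  fun δ hδ S hS => h δ hδ S (isDoorSetPG_mono hle hS)

/-- **BULK|door·G «BulkDefectGapDoorG»** — lens-3's `BulkDefectGapDoor` with the ONE extra hypothesis `IsEStarGSC (μS S)` on the door configuration
(exactly the instances K3 consumes: its `μ` is e⋆-GSC by `SparseMisfit`'s binder).  WEAKER-or-equal than BULK|door (`bulkDoorG_of_bulkDoor`).
[this file, g27] -/
def BulkDefectGapDoorG : Prop :=
  ∀ δ : ℝ, 0 < δ → ∀ θ : ℝ, 0 < θ → θ ≤ 1 / 16 → ∀ u : ℝ, 0 < u → u ≤ 1 →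
    ∃ η : ℝ, 0 < η ∧ ∃ C : ℝ, 0 ≤ C ∧ ∃ r : ℝ, 0 < r ∧ ∃ R₀ : ℝ, 1 ≤ R₀ ∧
      ∀ S : Set E3, IsDoorSet δ S → IsEStarGSC (μS S) → ∀ R : ℝ, R₀ ≤ R →
        u * nK (atomsIn (μS S) 0 R) ≤ nBad θ S (atomsIn (μS S) 0 R) →
        η * nK (atomsIn (μS S) 0 R) ≤ excess S (atomsIn (μS S) 0 R) + C * nBdry r S (atomsIn (μS S) 0 R)

/-- BULK|door ⟹ BULK|door·G (drop the GSC hypothesis). -/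
theorem bulkDoorG_of_bulkDoor (h : BulkDefectGapDoor) : BulkDefectGapDoorG := by
  intro δ hδ θ hθ hθ' u hu hu1
  obtain ⟨η, hη, C, hC, r, hr, R₀, hR₀, h'⟩ := h δ hδ θ hθ hθ' u hu hu1
  exact ⟨η, hη, C, hC, r, hr, R₀, hR₀, fun S hS _ R hR hd => h' S hS R hR hd⟩

/-- ★ **THE CUT in GSC currency: L1′♮_G(Λ, 1) ∧ HBG″(Λ) ⟹ BULK|door·G** (modus ponens at the shared literal `TwoPeriodic Λ S`, as K2″; HBG″ is
applied to GSC door sets only, so it needs no GSC twin). -/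
theorem bulkDoorG_of_periodicG {Λ : ℝ} (hP : DoorPeriodicPG Λ 1) (hG : PeriodicBulkGapDoor Λ) : BulkDefectGapDoorG := by
  intro δ hδ θ hθ hθ' u hu hu1
  obtain ⟨η, hη, C, hC, r, hr, R₀, hR₀, h⟩ := hG δ hδ θ hθ hθ' u hu hu1
  exact ⟨η, hη, C, hC, r, hr, R₀, hR₀, fun S hS hgsc R hR hd =>
    h S hS (hP δ hδ S ⟨(isDoorSetP_one_iff δ S).2 hS, hgsc⟩) R hR hd⟩

/-- ★ **K3_G** `BulkDefectGapDoorG → BindingSurface → WindowCounting → SparseMisfit ν` (`0 < ν ≤ 1/16`): the tree's K3 `sparseMisfit_of_bulkDoor`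
VERBATIM, except that the e⋆-GSC hypothesis `hgsc` of `SparseMisfit`'s binder — already in scope in K3 and used there only for `BindingSurface` —
is ALSO handed to BULK|door·G (one new line `hgsc'`, one changed application). -/
theorem sparseMisfit_of_bulkDoorG {ν : ℝ} (hν : 0 < ν) (hν' : ν ≤ 1 / 16)
    (hBu : BulkDefectGapDoorG) (hB : BindingSurface) (hW : WindowCounting) : SparseMisfit ν := by
  intro δ hδ ε hε
  obtain ⟨C₁, hC₁, hB'⟩ := hB δ hδ
  obtain ⟨C₀, hC₀, c₃, hc₃, hW₁⟩ := hW δ hδ 1 one_pos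
  set P : ℝ := (2 / δ + 1) ^ 3 with hPdef
  have hP : 0 < P := by positivity
  set u : ℝ := min 1 (ε * c₃ / (2 * P)) with hudef
  have hu : 0 < u := lt_min one_pos (by positivity)
  have hu1 : u ≤ 1 := min_le_left _ _
  have hu2 : u ≤ ε * c₃ / (2 * P) := min_le_right _ _
  obtain ⟨η, hη, C, hC, r, hr, R₀, hR₀, hBu'⟩ := hBu δ hδ ν hν hν' u hu hu1
  obtain ⟨C₂, hC₂, c₃', hc₃', hW₂⟩ := hW δ hδ r hr
  set A : ℝ := (C₁ + C * C₂) / (η * c₃) with hA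
  have hA0 : 0 ≤ A := by positivity
  have hR₀0 : 0 < R₀ := by linarith
  refine ⟨2 * A / ε + R₀, by positivity, ?_⟩
  intro μ hroot hclean hnash hchart hgsc
  set R : ℝ := 2 * A / ε + R₀ with hRdef
  have hR1 : 1 ≤ R := by
    have : 0 ≤ 2 * A / ε := by positivity
    linarith
  have hRR₀ : R₀ ≤ R := by
    have : 0 ≤ 2 * A / ε := by positivity
    linarith
  have hR0 : 0 < R := by linarith
  have hpack : nK (atomsIn μ 0 R) ≤ P * R ^ 3 := nK_atomsIn_le hδ hroot hR1
  obtain ⟨S, h0S, hsep, hμ⟩ := hroot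
  have hatom : ∀ p : E3, μ {p} ≠ 0 ↔ p ∈ S := by
    intro p; rw [hμ]; exact Literature.Probability.Process.count_restrict_singleton_ne_zero_iff S p
  have hKS : atomsIn μ 0 R ⊆ S := fun p hp => (hatom p).1 hp.1
  have hKfin : (atomsIn μ 0 R).Finite := by
    have hf : (Metric.closedBall (0 : E3) R ∩ S).Finite :=
      Literature.Probability.Process.LocalConfig.finite_inter_of_separated hδ hsep (isCompact_closedBall (0 : E3) R)
    exact hf.subset fun p hp => ⟨Metric.mem_closedBall.2 hp.2, (hatom p).1 hp.1⟩
  have hclean' : IsClean (μS S) := by have h := hclean; rw [hμ] at h; exact h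
  have hnash' : IsNash (μS S) := by have h := hnash; rw [hμ] at h; exact h
  have hchart' : IsCharted (μS S) := by have h := hchart; rw [hμ] at h; exact h
  have hdoor : IsDoorSet δ S := ⟨h0S, hsep, hclean', hnash', hchart'⟩
  have hgsc' : IsEStarGSC (μS S) := by have h := hgsc; rw [hμ] at h; exact h
  -- BULK|door·GSC on this window, moved to the `μ`-vocabulary once and for all
  have hbulkμ : u * nK (atomsIn μ 0 R) ≤ nBad ν S (atomsIn μ 0 R) →
      η * nK (atomsIn μ 0 R) ≤ excess S (atomsIn μ 0 R) + C * nBdry r S (atomsIn μ 0 R) := by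
    have h := hBu' S hdoor hgsc' R hRR₀
    have hwin : atomsIn (μS S) 0 R = atomsIn μ 0 R := by
      ext p; simp only [atomsIn, Set.mem_setOf_eq, hμ]
    simpa only [hwin] using h
  -- the μGSC surface bound and the counting bounds, in the chunk vocabulary
  have hbind : excess S (atomsIn μ 0 R) ≤ C₁ * R ^ 2 := by
    have h := hB' μ ⟨S, h0S, hsep, hμ⟩ hgsc R hR1
    unfold excess
    rw [hμ] at h ⊢
    exact h
  obtain ⟨hbd, -⟩ := hW₂ μ ⟨S, h0S, hsep, hμ⟩ hclean R hR1
  obtain ⟨-, hdens⟩ := hW₁ μ ⟨S, h0S, hsep, hμ⟩ hclean R hR1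
  have hbd' : nBdry r S (atomsIn μ 0 R) ≤ C₂ * R ^ 2 := by
    unfold nBdry
    rw [hμ] at hbd ⊢
    exact hbd
  -- each unmatched atom of the window weighs at most 1/(c₃ R³)
  have hterm : ∀ p ∈ badIn ν μ (atomsIn μ 0 R), (1 : ℝ) / (Set.ncard (atomsIn μ p R) : ℝ) ≤ 1 / (c₃ * R ^ 3) := by
    intro p hp
    have hp' : p ∈ atomsIn μ 0 R := hp.1
    have hd := hdens p hp'.1 hp'.2
    exact one_div_le_one_div_of_le (by positivity) hd
  have hbadfin : (badIn ν μ (atomsIn μ 0 R)).Finite := hKfin.subset (fun p hp => hp.1)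
  have hfrac : windowBadFrac ν R μ ≤ (Set.ncard (badIn ν μ (atomsIn μ 0 R)) : ℝ) * (1 / (c₃ * R ^ 3)) := by
    unfold windowBadFrac
    rw [finsum_mem_eq_finite_toFinset_sum _ hbadfin, Set.ncard_eq_toFinset_card _ hbadfin]
    have hs := Finset.sum_le_card_nsmul hbadfin.toFinset (fun p => (1 : ℝ) / (Set.ncard (atomsIn μ p R) : ℝ)) (1 / (c₃ * R ^ 3))
      (fun p hp => hterm p (hbadfin.mem_toFinset.1 hp))
    simpa [nsmul_eq_mul] using hs
  have hbadμ : (Set.ncard (badIn ν μ (atomsIn μ 0 R)) : ℝ) = nBad ν S (atomsIn μ 0 R) := by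
    unfold nBad
    rw [hμ]
  have hR3 : 0 < c₃ * R ^ 3 := by positivity
  have hc₃0 : c₃ ≠ 0 := hc₃.ne'
  have hη0 : η ≠ 0 := hη.ne'
  have hRne : R ≠ 0 := hR0.ne'
  -- THE DENSITY DICHOTOMY on the window
  have hgoal : nBad ν S (atomsIn μ 0 R) * (1 / (c₃ * R ^ 3)) ≤ ε := by
    rcases lt_or_ge (nBad ν S (atomsIn μ 0 R)) (u * nK (atomsIn μ 0 R)) with hlt | hge
    · -- sparse window: the threshold alone bounds the bad fraction
      have h1 : nBad ν S (atomsIn μ 0 R) ≤ u * (P * R ^ 3) := hlt.le.trans (mul_le_mul_of_nonneg_left hpack hu.le)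
      have h2 : u * (2 * P) ≤ ε * c₃ := (le_div_iff₀ (by positivity)).1 hu2
      calc nBad ν S (atomsIn μ 0 R) * (1 / (c₃ * R ^ 3)) ≤ u * (P * R ^ 3) * (1 / (c₃ * R ^ 3)) :=
            mul_le_mul_of_nonneg_right h1 (by positivity)
        _ = u * P / c₃ := by field_simp
        _ ≤ ε / 2 := by
            rw [div_le_iff₀ hc₃]
            nlinarith [h2]
        _ ≤ ε := by linarith
    · -- dense window: BULK|door bounds the whole window by its surface
      have hbulk : η * nK (atomsIn μ 0 R) ≤ excess S (atomsIn μ 0 R) + C * nBdry r S (atomsIn μ 0 R) := hbulkμ hge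
      have h2 : C * nBdry r S (atomsIn μ 0 R) ≤ C * (C₂ * R ^ 2) := mul_le_mul_of_nonneg_left hbd' hC
      have hnK : nK (atomsIn μ 0 R) ≤ (C₁ + C * C₂) * R ^ 2 / η := by
        rw [le_div_iff₀ hη]
        have : η * nK (atomsIn μ 0 R) ≤ C₁ * R ^ 2 + C * (C₂ * R ^ 2) := by linarith [hbulk, hbind, h2]
        linarith [this]
      have h3 : nBad ν S (atomsIn μ 0 R) ≤ (C₁ + C * C₂) * R ^ 2 / η := (nBad_le_nK ν (S := S) hKfin).trans hnK
      calc nBad ν S (atomsIn μ 0 R) * (1 / (c₃ * R ^ 3)) ≤ (C₁ + C * C₂) * R ^ 2 / η * (1 / (c₃ * R ^ 3)) :=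
            mul_le_mul_of_nonneg_right h3 (by positivity)
        _ = A / R := by
            rw [hA]
            field_simp
        _ ≤ ε / 2 := by
            rw [div_le_iff₀ hR0]
            have hR₀0 : 0 ≤ R₀ := by linarith
            have : 2 * A / ε ≤ R := by linarith
            have h' : 2 * A ≤ R * ε := by rwa [div_le_iff₀ hε] at this
            linarith
        _ ≤ ε := by linarith
  have hfin : (Set.ncard (badIn ν μ (atomsIn μ 0 R)) : ℝ) * (1 / (c₃ * R ^ 3)) ≤ ε := by
    rw [hbadμ]
    exact hgoal
  exact hfrac.trans hfin

/-- **K4_G** the door corollaries: `BulkDefectGapDoorG → VisibleGap (1/50) ∧ PertRegime (1/50)`, door (`MuEquilibriumDoor`, p816834), `SparseNull`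
(p815496), `BindingSurface` (p816066), `WindowCounting` (p813143) discharged BY NAME through `ChartedPlanarOrderDoorDischarged`. -/
theorem gap_and_pert_1_50_of_bulkDoorG (hBu : BulkDefectGapDoorG) : VisibleGap (1 / 50) ∧ PertRegime (1 / 50) :=
  ⟨ChartedPlanarOrderDoorDischarged.visibleGap_of_sparseMisfit (1 / 50)
      (sparseMisfit_of_bulkDoorG (by norm_num) (by norm_num) hBu ChartedPlanarOrderBindingSurface.bindingSurface_holds
        ChartedPlanarOrderWindowCounting.windowCounting_holds),
    ChartedPlanarOrderDoorDischarged.pertRegime_of_sparseMisfit (1 / 50) fun η hη hη' =>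
      sparseMisfit_of_bulkDoorG hη hη' hBu ChartedPlanarOrderBindingSurface.bindingSurface_holds
        ChartedPlanarOrderWindowCounting.windowCounting_holds⟩

/-- ★★ **the GSC-door Liouville leaf decides N's registered conclusions**: `DoorPeriodicPG Λ 1 → PeriodicBulkGapDoor Λ → VisibleGap (1/50) ∧
PertRegime (1/50)` for every `Λ` (cf. the tree's `gap_and_pert_1_50_of_periodic` for `DoorPeriodic Λ`). -/
theorem gap_and_pert_1_50_of_periodicG {Λ : ℝ} (hP : DoorPeriodicPG Λ 1) (hG : PeriodicBulkGapDoor Λ) :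
    VisibleGap (1 / 50) ∧ PertRegime (1 / 50) :=
  gap_and_pert_1_50_of_bulkDoorG (bulkDoorG_of_periodicG hP hG)

/-- sanity: the old leaf still decides through the new column (`DoorPeriodic Λ ⟹ DoorPeriodicPG Λ 1`). -/
theorem gap_and_pert_1_50_of_periodic_viaG {Λ : ℝ} (hP : DoorPeriodic Λ) (hG : PeriodicBulkGapDoor Λ) :
    VisibleGap (1 / 50) ∧ PertRegime (1 / 50) :=
  gap_and_pert_1_50_of_periodicG (doorPeriodicPG_one_of_doorPeriodic hP) hG

end Summit.AtomisticToContinuum.Crystallization.Theorems.ChartedZeroExcessLayeredLatticeLiouville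

end
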